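import Mathlib
import HarnessLib
import HarnessLib.Audit
import Summits.ValiantsHypothesis.Statement
import Literature.Computability.AlgebraicComplexity.DeterminantalComplexity
import Literature.Computability.AlgebraicComplexity.ValiantConjectureEquivProofs
import Literature.Computability.AlgebraicComplexity.SymmetricArithCircuit
import HarnessLib.Audit.Status.Attr

/-!
Route: TwistedDetRank

DORMANT since 2026-08-27T19:00:57Z (tenure g2 per director-valiant g8 2026-08-27T17:55:59Z (2): both open conjuncts calibrated ≥ VNP⊄VBP (p551099/p552122/p551732); natural target = FRONTIER statement DcPerSuperpolynomial ℂ; VH-free resi) — unstaffed, not closed; items shared with open routes are served there. `ledger route dormant <id> --off` reactivates.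

# Route TwistedDetRank — twisted-determinantal rank — per_n needs super-quasi-polynomially many
Hadamard-twisted determinants, easy class-function GMFs need few

TWISTED-DETERMINANTAL RANK (card twisted-determinantal-rank). For E ∈ ℂ^{n×n} the twisted
determinant is
det(X∘E) = Σ_σ sgn(σ) Π_i E_{σ(i),i} X_{σ(i),i}; for a polynomial f supported on permutation
monomials (a GMF)
tdr(f) := min r with f = Σ_{t<r} det(X∘E_t). For the permanent, tdr(per_n) = min r with sgn =
Σ_{t<r} E_t^ on S_n
= the rank of the point sgn ∈ ℂ^{S_n} with respect to the affine cone over the Birkhoff toric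
variety
(tdr(per_3) = 2 over ℚ(ζ_3); ⌊n/3⌋+1 ≤ tdr(per_n) ≤ n!). It suffices to show X = X1 ∧ X2:
X1 (TdrPerNotQP, restricted-model lower bound): n ↦ tdr(per_n) is not quasi-polynomially bounded;
X2 (FermionicNormalForm, transfer): every p-computable family f_n = Σ_σ χ_n(σ) Π_i X_{σ(i),i} whose
coefficient
χ_n is a CLASS FUNCTION on S_n has quasi-polynomially bounded tdr. X2 is the card's thesis (B) filed
on the
class-function (immanant) slice: the unrestricted form is threatened by direct sums per_3 ⊕ … ⊕
per_3 (a VP_e family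
whose tdr is the Birkhoff-cone product rank of sgn_3^{⊗m}, between m+1 and 2^m), and that dichotomy
is filed as
its own crux DirectSumExp (if true it yields exponential X1 by block restriction; if false X1 needs
the global
structure of S_n and the unrestricted (B) revives).
Lean: `(¬ ∃ c : ℕ, ∀ n : ℕ, ∃ r ≤ 2 ^ ((Nat.log 2 n + c) ^ c), ∃ E : Fin r → Matrix (Fin n) (Fin n)
ℂ, Literature.Computability.AlgebraicComplexity.perPoly (Fin n) ℂ = ∑ t, (Matrix.of fun i j =>
MvPolynomial.C (E t i j) * MvPolynomial.X (i, j)).det) ∧ (∀ χ : (n : ℕ) → Equiv.Perm (Fin n) → ℂ, (∀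
(n : ℕ) (σ τ : Equiv.Perm (Fin n)), χ n (τ * σ * τ⁻¹) = χ n σ) →
Literature.Computability.AlgebraicComplexity.IsPComputable (fun n => ∑ σ : Equiv.Perm (Fin n),
MvPolynomial.C (χ n σ) * ∏ i : Fin n, (MvPolynomial.X (σ i, i) : MvPolynomial (Fin n × Fin n) ℂ)) →
∃ c : ℕ, ∀ n : ℕ, 1 ≤ n → ∃ r ≤ 2 ^ ((Nat.log 2 n + c) ^ c), ∃ E : Fin r → Matrix (Fin n) (Fin n) ℂ,
(∑ σ : Equiv.Perm (Fin n), MvPolynomial.C (χ n σ) * ∏ i : Fin n, (MvPolynomial.X (σ i, i) :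
MvPolynomial (Fin n × Fin n) ℂ)) = ∑ t, (Matrix.of fun i j => MvPolynomial.C (E t i j) *
MvPolynomial.X (i, j)).det)`

## Assembly
Pure logic plus one proved cone fact (checked sorry-free in the planner's Sketch.lean): assume VP ℂ
= VNP ℂ; then the
permanent family is p-computable
(`Literature.Computability.AlgebraicComplexity.isPComputable_perPoly_complex_iff`,
discharged in tree by `perNotPComputableComplex_iff_holds`, ValiantConjectureEquivProofs.lean);
per_n is the
class-function GMF with χ ≡ 1 (`simp [perPoly, Matrix.permanent, Matrix.mvPolynomialX]`), so
FermionicNormalForm gives a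
quasi-polynomial bound on tdr(per_n), contradicting TdrPerNotQP. No hub item, no renaming bridge
needed.

Rationale: WHY THIS LINE. The model "sums of r Hadamard-twisted n×n determinants" fixes the variable placement
and lets only scalings vary; it
sits strictly between Pólya/Marcus–Minc (r = 1 impossible for n ≥ 3, [MarcusMinc1961]) and
determinantal complexity
(a sum of r twisted determinants has dc ≤ poly(r, n), so X1 is implied by DetQP's thesis and is the
cheapest honest
consequence of VH in this direction not yet proved), and its ±1 shadow is the Pfaffian-number /
Arf-invariant theory
of matchings on surfaces ([Tesler2000] 2^h Pfaffians with entries ±1, ±i for Euler genus h;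
[LoeblMasbaum2011] Ising
complexity = 4^g exactly; Norine doi:10.1007/s00493-009-2354-0), which complex twists provably beat
(tdr(per_3) = 2 < 4).
Imported areas: toric/secant geometry of the Birkhoff polytope (X1 is an X-rank statement about one
explicit point;
flattenings are provably blind because cone elements factor exactly on the sub-families where sgn
factors),
asymptotic (non-)multiplicativity of restricted ranks under tensor powers
(doi:10.1016/j.laa.2017.12.020,
doi:10.1137/18m1174829, doi:10.1090/bull/1880) for the direct-sum crux, and the
immanant/class-function slice
([Curticapean2021], [MertensMoore2013]) with the free-fermion (Slater-rank) reading of twisted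
determinants for X2.
What it adds to existing routes: DetQP/GCTMult bound ALL determinantal expressions by geometry of
{det = 0}; here the
expression is frozen to the identity placement, the invariant is a single integer per n with exact
small values
(2, 3, 7–8 numerically for n = 3, 4, 5), and the transfer conjecture X2 is new; the negatives index
is empty.

RANKED CRUXES. #0 Target (target) — X = TdrPerNotQP ∧ FermionicNormalForm (X1 ∧ X2 of the Thesis;
written out in full so the decl has no forward references). (why it might fail: X2 has no mechanism
of its own on the class-function slice beyond classification of cheap class functions, and X1 needs
a lower-bound technique past flattenings, Arf invariants and Hessian rank.) [MarcusMinc1961,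
Tesler2000, LoeblMasbaum2011, Curticapean2021]
#2 FermionicNormalForm (crux) — (card thesis (B), class-function slice) for every family χ_n of
class functions on S_n, if f_n = Σ_σ χ_n(σ) Π_i X_{σ(i),i} is p-computable over ℂ then there is c
with tdr(f_n) ≤ 2^((log₂ n + c)^c) for all n, i.e. f_n is a sum of quasi-polynomially many twisted
determinants ("every efficiently computable class-function permutation amplitude is a short
superposition of free-fermion amplitudes"). Consistent with all known cheap class functions:
sgn·F(c_1)·P(c_2..c_k) (interpolation in det(X∘(J+(u−1)I)) and cycle twists) and functions supported
on permutations moving ≤ k points (moment/Prony twists I + rank-one) have polynomial tdr; per, HC,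
fermionants, D^even are believed hard. [difficulty: open-problem] (why it might fail: A p-computable
class-function family with cuspidal support and no short expansion: D^even_n = sgn·[all cycles even]
or the even half of Ferm_2, if either is in VP; or a family supported on permutations moving ≤
polylog n points whose tdr is not quasi-polynomial.) [Curticapean2021, MertensMoore2013,
Burgisser2000, Tesler2000, arXiv:quant-ph/0012094] [rev 7 (tenure g1, A1, 2026-08-27): DERIVED
PARENT — `closes` consumes its two VBP-redirect pieces X2a SliceVPInVBP (#8, RESIDUAL) and X2b
SliceVBPFermionic (#6, ATTACKED) through the proved glue FermionicNormalFormOfSlices (#9); held on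
the ledger (needs stmt-17992 + stmt-17991); `valiantsHypothesis_of_fermionicNormalForm`
(Theorems/TwistedDetRankFermionicNormalForm.lean) records that X2 alone gives VH, which is why it is
split; direct attempts low priority.]
#3 TdrPerNotQP (crux) — (card thesis (A), in the form the assembly consumes) the
twisted-determinantal rank of the permanent is not quasi-polynomially bounded: there is no c such
that for every n, per_n is a sum of at most 2^((log₂ n + c)^c) polynomials det(X∘E_t), E_t ∈
ℂ^{n×n}. Equivalently sgn ∈ ℂ^{S_n} is not a sum of quasi-polynomially many points of the Birkhoff
cone {π ↦ Π_i E_{π(i),i}}. Implied by DetQP's thesis (dc of a sum of r twisted n×n determinants is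
poly(r,n)); known: ⌊n/3⌋+1 ≤ tdr(per_n) ≤ n!. [difficulty: open-problem] (why it might fail: False
only if per_n is a 2^polylog-term sum of twisted determinants (a VQP-type normal form, against
DetQP's thesis); the live risk is unprovability: flattenings are blind (cone elements factor exactly
where sgn factors), Arf invariants need ±1 twists, Hessian rank gives only ~n/2.)
[MignonRessayre2004, MarcusMinc1961, LoeblMasbaum2011, Tesler2000, doi:10.1007/s00493-009-2354-0,
IkenmeyerLandsberg2017]
#4 DirectSumExp (crux) — (direct-sum dichotomy, exponential side) there is c > 0 such that for all
m, every representation of per_3 ⊕ … ⊕ per_3 (the product of the permanents of the m diagonal 3×3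
blocks of a (Fin m × Fin 3)-indexed generic matrix) as a sum of r twisted determinants of the full
matrix has r ≥ 2^(c·m). Equivalently the Birkhoff-cone(Y_3 ⊂ ℂ^6, the cubic fourfold
z_{e1}z_{e2}z_{e3} = z_{o1}z_{o2}z_{o3}) product rank R(m) of sgn_3^{⊗m} grows exponentially (known
m+1 ≤ R(m) ≤ 2^m, R(1) = 2, R(2) = 3). With TdrBlockMonotone it gives tdr(per_n) ≥ 2^(c⌊n/3⌋), hence
TdrPerNotQP; it also shows why X2 must live on the class-function slice. Its refutation (R(m) =
2^{o(m)}) would revive the card's unrestricted (B) and force X1 through global structure.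
[difficulty: L] (why it might fail: R(2)=3<4 already (both factor sets = the 3 lines of a plane
through sgn); shared-parameter interpolation along rational cubic curves in Y_3, or border-rank
degenerations, may give R(m)=poly(m); no lower-bound tool beyond substitution (R(m) ≥ R(m−1)+2) is
known.) [doi:10.1016/j.laa.2017.12.020, doi:10.1137/18m1174829, doi:10.1090/bull/1880,
Landsberg2017, Tesler2000]
#5 TdrPerSuperlinear (crux) — (first honest rung of X1) tdr(per_n)/n → ∞: for every C there is n₀
such that for n ≥ n₀ every representation of per_n as a sum of r twisted determinants has r > C·n.
Known: r ≥ ⌊n/3⌋+1 (superadditivity, TdrSuperadditive) and numerically tdr(per_4) = 3, tdr(per_5) ∈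
{7, 8} = the generic rank ⌈n!/((n−1)²+1)⌉ so far. [difficulty: L] (why it might fail: Only ⌊n/3⌋+1 ≤
tdr(per_n) is proved; substitution adds O(1) per block and no invariant sees general complex twists;
if DirectSumExp fails, linear growth of tdr(per_n) contradicts nothing proved (only the belief VBP ≠
VNP).) [MignonRessayre2004, LoeblMasbaum2011, AlperBogartVelasco2017,
doi:10.1016/j.disc.2010.10.014, MarcusMinc1961]
#6 SliceVBPFermionic (crux) — ATTACKED CONJUNCT · stmt-17991 — X2b, the NORMAL-FORM half of X2 on
VBP: every class-function GMF family f_n = Σ_σ χ_n(σ) Π_i X_{σ(i),i} with polynomially bounded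
affine determinantal complexity has quasi-polynomially bounded tdr. With X2a it gives X2 through the
PROVED glue FermionicNormalFormOfSlices (Theorems/TwistedDetRankFermionicNormalFormOfSlices.lean).
Calibrations landed by the first prover val-width-17991-p1
(Theorems/TwistedDetRankSliceVBPFermionicCalibration.lean p551732, …ReturnGadget.lean p553086):
`dcPerSuperpolynomial_of_sliceVBPFermionic` (X2b → DcPerSuperpolynomial ℂ = VNP ⊄ VP_ws, so X2b is
at least Valiant's weak hypothesis), `sliceVBPFermionic_iff`,
`sliceVBPFermionic_of_symA_of_restorationVBP` (the registered line), bipartite return gadget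
`hasDetRepr_perPoly_of_hasDetRepr_gmf`. This is the conjunct the route ATTACKS (director-valiant g8
2026-08-27T17:43:59Z). [difficulty: open-problem] (why it might fail: polynomial dc but exponential
tdr — the 2-cycle twist χ = sgn·μ^{c₂} (μ ≠ ±1) has tdr ≥ 2^{n/4} by the landed block-swap
flattening; it refutes X2b iff its GMF has polynomial dc, expected VNP-hard.)
[LandsbergRessayre2017, DawarWilsenach2025, DawarPagoSeppelt2025, Curticapean2021, Burgisser2000,
MarcusMinc1961]
#6 TdrBlockMonotone (support) — block restriction keeps the number of twisted determinants: if 3m ≤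
n and per_n is a sum of r twisted determinants then per_3 ⊕ … ⊕ per_3 (m blocks, (Fin m × Fin
3)-indexed) is a sum of r twisted determinants (evaluate off-block variables to 0 and leftover
diagonal variables to 1; a twisted determinant maps to a scalar multiple of a block-diagonally
twisted determinant). [difficulty: provable-now] [Valiant1979, MarcusMinc1961]
#7 DirectSumToTdr (support) — glue: DirectSumExp and TdrBlockMonotone imply TdrPerNotQP (2^(c⌊n/3⌋)
eventually exceeds 2^((log₂ n + c')^c'); elementary real analysis plus the two items). [difficulty:
provable-now] [Burgisser2000]
#8 SliceVPInVBP (crux) — RESIDUAL · HELD (not staffed) · stmt-17992 · ONE item shared with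
ImmanantSlice's split child SliceVBP — X2a, the COLLAPSE half of X2: every p-computable
class-function GMF family has polynomially bounded dc, dc(f_n) ≤ n^c + c (VP = VP_ws on the
class-function slice; the quasi-polynomial version holds for all of VP, `VP_subset_VQP_holds`).
SUMMIT-CALIBRATED by the first prover val-width-17992-p1
(Theorems/TwistedDetRankSliceVPInVBPCalibration.lean, p551099 + p552122;
Cruxes/SliceVPInVBP/CALIBRATION.md): `dcPerSuperpolynomial_of_not_sliceVPInVBP` (¬X2a →
DcPerSuperpolynomial ℂ: a refutation proves VNP ⊄ VP_ws),
`valiantsHypothesis_of_sliceVPInVBP_of_dcPerSuperpolynomial` (X2a → DcPerSuperpolynomial ℂ → VH: a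
proof proves the open weak⇒strong transfer), `sliceVPInVBP_or_dcPerSuperpolynomial` (X2a ∨
DcPerSuperpolynomial ℂ outright), `sliceVPInVBP_iff` (X2a ↔ ¬DcPerSuperpolynomial ℂ ∨ (VH ∧ X2a));
`closes` uses X2a only at χ ≡ 1, where it IS the transfer DcPerSuperpolynomial ℂ → VH. DECLARED THIS
ROUTE'S RESIDUAL = the imported complement of the conjunct split X2 ⇐ X2a ∧ X2b (tribunal T1′ rule;
director-valiant g8 rulings 2026-08-27T17:43:59Z and 17:52:55Z): not staffed (item HELD on the
ledger 2026-08-27T18:14Z with this declaration as the hold note), no further provers, exempt from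
T3/T4, counted ONCE per summit (together with ImmanantSlice); tribunal flag `--residual
SliceVPInVBP`. Ledger kind stays `crux`: the gate has no `residual` kind, and a load-bearing binder
re-badged `aside` is re-promoted to crux by the cone pass (cone.rekinded.repromoted — observed rev 8
→ 9 and rev 11), so the HOLD + this paragraph are the carriers of the residual declaration while the
decl stays a binder of `closes`. Prover's alternative of record, NOT opened (FRONTIER ledger,
21-frontier's decision): re-target the route at DcPerSuperpolynomial ℂ with X2b-at-per as the single
crux. [MalodPortier2008, Burgisser2000, MignonRessayre2004, DawarPagoSeppelt2025, RazYehudayoff2008]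
#9 FermionicNormalFormOfSlices (support) — PROVED · stmt-17993 — the glue X2a → X2b → X2
(SliceVPInVBP → SliceVBPFermionic → FermionicNormalForm), PROVED
(Theorems/TwistedDetRankFermionicNormalFormOfSlices.lean); it is the fourth binder of `closes` (rev
7). [Burgisser2000, MalodPortier2008]
#9 TdrSuperadditive (support) — superadditivity tdr(per_{a+b}) ≥ tdr(per_a) + tdr(per_b) − 1, in
representation form: from a length-r representation of per_{a+b} one gets representations of per_a
and per_b of lengths r₁, r₂ with r₁ + r₂ ≤ r + 1 (restrict to S_a × S_b: sgn_a ⊗ sgn_b = Σ_t u_t ⊗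
v_t with u_t, v_t in the cones; a functional e with e(sgn_a) = 1 killing tdr(per_a) − 1 of the u_t
leaves sgn_b as a combination of the remaining v_t). Gives tdr(per_n) ≥ ⌊n/3⌋ + 1 with TdrPerThree's
converse bound r = 1 impossible. [difficulty: provable-now] [MarcusMinc1961,
doi:10.1016/j.laa.2017.12.020]
#9 TdrPerThree (support) — calibration tdr(per_3) ≤ 2: per_3 = a·det(X) + (1−a)·det(X∘F) with F =
[[1,z²,1],[1,1,z²],[z²,1,1]], z = e^{2πi/3}, a = (1+z)/(1−z) (F^ = 1 on A_3, z² on odd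
permutations); absorb a and 1−a into the first rows. Complex twists beat Tesler's two Gaussian-unit
Pfaffians for K_{3,3} ⊂ RP² only in field of definition (ℚ(ζ_3)); r = 1 is impossible (Marcus–Minc).
[difficulty: provable-now] [Tesler2000, MarcusMinc1961, AlperBogartVelasco2017]
#9 TdrPerFactorial (support) — trivial upper bound tdr(per_n) ≤ n!: per_n = Σ_τ sgn(τ)·det(X∘P_τ)
over the n! permutation matrices (first exercise for the twisted-determinant API; the true order is
open between linear and n!, numerics suggest the generic rank ⌈n!/((n−1)²+1)⌉). [difficulty:
provable-now] [Valiant1979, MarcusMinc1961]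

TWO-LAYER PLAN. Foreseen glued splits (none filed now): TdrPerNotQP ⇐ DirectSumExp →
TdrBlockMonotone → TdrPerNotQP (already typed as
support DirectSumToTdr; becomes the decomposition of X1 the day DirectSumExp closes); DirectSumExp ⇐
PlaneModelExp
(exponential lower bound for decompositions whose factors in each position lie in a plane through
sgn_3 = signed
subcube representations of θ^{|x|} on {0,1}^m) → PlaneReduction (every minimal decomposition is of
that form, or a
rank-loss lemma) → DirectSumExp; FermionicNormalForm ⇐ QuasiLocalHaveSmallTdr (End1 + End2 class
functions have
quasi-polynomial tdr, provable) → CheapClassFunctionsAreQuasiLocal (shared in spirit with card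
cuspidal-rigidity-immanant-slice) → FermionicNormalForm.

KILL CRITERIA. FermionicNormalForm refuted by an explicit p-computable class-function family with
super-quasi-polynomial tdr ⇒ close
`refuted:FermionicNormalForm` unless the witness is excluded by a natural strengthening of the slice
(then restate once).
TdrPerNotQP refuted (per_n a 2^polylog-term twisted sum) ⇒ close refuted: per would have
quasi-polynomial determinantal
expressions and DetQP dies with it. DirectSumExp refuted (R(m) = 2^{o(m)}) does NOT close the route:
drop it, keep X1 via
TdrPerSuperlinear, and re-file the card's unrestricted (B). TdrPerSuperlinear refuted (tdr(per_n) =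
O(n)) ⇒ close refuted
(and report dc(per_n) = poly(n), i.e. VBP = VNP-level news). DetQP's thesis proved elsewhere ⇒ X1
becomes a corollary; CR
(cuspidal rigidity) proved elsewhere ⇒ VH directly, route superseded. RESIDUAL BOOKKEEPING (rev 8,
tenure g2): SliceVPInVBP (X2a, #8) is NOT attacked on this route — a REFUTATION of it is a PROOF of
DcPerSuperpolynomial ℂ = VNP ⊄ VP_ws (`dcPerSuperpolynomial_of_not_sliceVPInVBP`): bank the theorem,
and the line then stands or falls with X2b at χ ≡ 1 (re-target at DcPerSuperpolynomial ℂ, FRONTIER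
ledger); a PROOF of it banks the weak⇒strong transfer
(`valiantsHypothesis_of_sliceVPInVBP_of_dcPerSuperpolynomial`). SliceVBPFermionic (X2b, #6) refuted
by an explicit polynomial-dc class-function GMF of super-quasi-polynomial tdr ⇒ FermionicNormalForm
is refuted with it (VBP ⊆ VP) ⇒ close `refuted:SliceVBPFermionic`.

NOT DECOMPOSED YET. The unrestricted (B) of the card (all GMF families, not only class functions) —
deliberately NOT filed until DirectSumExp
is decided; the VQP-uniform form of X2 (quasi-polynomial circuits in, quasi-polynomial tdr out);
intermediate twist
groups (μ_N-valued or unit-modulus twists, where an Arf/quadratic-form invariant à la Loebl–Masbaum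
might survive); the
(n−2)-nullity equations and the equations of σ_r of the Birkhoff toric variety as a Lean-typable
necessary condition;
border (closure) versions of tdr; exact values tdr(per_4) = 3, tdr(per_5) ∈ {7,8} (kit
certification); the ABP/dc
bound "sum of r twisted n×n determinants has dc ≤ poly(r,n)" linking X1 to DetQP. All are layer-2
children or
support lemmas (`--supports`), later.

CHEAPEST FALSIFIER. Compute R(3) and R(4) (crux DirectSumExp): least-squares / Gröbner over u = E^
(9 complex parameters per factor) for
sgn_3^{⊗m} = Σ_{t<r} ⊗_i u_{t,i}, 6^m equations — R(3) ∈ {4,5,6}?, R(4) ≤ 9? A pattern 2, 3, 4, 5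
(linear) kills
DirectSumExp and revives unrestricted (B); 2, 3, 5, 8–9 supports it. In the plane model (factors of
position i inside
one plane through sgn) the planner's hand analysis gives R_plane(1,2,3) = 2, 3, ≥5 (signed-subcube
representations of
θ^{|x|}: the m = 2 minimal representation {00, 11, **} is unique, and no 4-term representation
exists for m = 3).
The kit socket was absent this session (compute.sock missing), so the job `kit_dsum/main.py` in the
planner folder was
written but not run. Second cheapest: is D^even_n (sgn·[all cycles even] = [z_1⋯z_n]
sqrt(det(I−ZX)det(I+ZX))) in VP?
(kills FermionicNormalForm only together with a tdr lower bound, but flags it suspect).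

NUMBERS. tdr(per_3) = 2 (exact, ℚ(ζ_3)); tdr(per_4) = 3, tdr(per_5) ∈ {7, 8} (numerics, refuter
triage-9) = generic rank
⌈n!/((n−1)²+1)⌉ = 2, 3, 8; lower bound ⌊n/3⌋+1; upper bounds n! (permutation matrices), n^{O(n)}
(2n-wise independent
signings in per = E_ε[det ε · det(X∘ε)]), 2^{⌈(n−2)²/2⌉} (Tesler crosscap formula, worse); ±1-twist
analogue: Ising
complexity 4^g exactly (LoeblMasbaum2011 Thms 3–4), pNor ∉ {2,3,5} (Norine), pNor = 6 exists
(Miranda–Lucchesi);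
dc(per_n) ≥ n²/2 (MignonRessayre2004), dc(per_3) = 7 (AlperBogartVelasco2017); direct sums: R(1) =
2, R(2) = 3,
m+1 ≤ R(m) ≤ 3^{⌈m/2⌉}. Items at open: 11 (target, assembly, 4 cruxes, 5 supports).

DEFINITION REQUESTS. None blocking: tdr is inlined as "f is a sum of r twisted determinants" (`∃ E :
Fin r → Matrix (Fin n) (Fin n) ℂ, f = ∑ t,
(Matrix.of fun i j => MvPolynomial.C (E t i j) * MvPolynomial.X (i, j)).det`). A convenience
definition
`twistedDetRank` under Summits/ValiantsHypothesis/ValiantsHypothesis/Theorems may be filed by the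
first prover with
`--supports`; no Literature notion is missing (perPoly, IsPComputable, IsQPBounded exist).

SUPPORT. Route-repair rev 2 (2026-08-15, cone guardrail; planner rrepair g2): needs-fact: NONE. The
route file imports only the
gate boilerplate (Mathlib, HarnessLib, HarnessLib.Audit) and the operator's
Summits.ValiantsHypothesis.Statement, so 0 imports are
droppable and 0 cruxes are restated. The unproved named Props the priority view counted in the
IMPORT cone all enter through
Statement.lean's own imports of Literature.Computability.AlgebraicComplexity.ValiantConjecture /
ValiantClasses and no route edit can
remove them: `VPNeVNPComplex` (@[conjecture]; definitionally the summit `ValiantsHypothesis` =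
`Literature.PNP.ValiantHypothesis ℂ`
= `VP ℂ ≠ VNP ℂ`) and `PerNotPComputableComplex` (@[conjecture]; equivalent to it by the PROVED
`Literature.Computability.AlgebraicComplexity.perNotPComputableComplex_iff_holds`,
ValiantConjectureEquivProofs.lean) ARE the
target and are never to be discharged as facts — no prover should be seated on them; the third
undischarged Prop of that cone,
`IsVNPFamily.of_isPProjection` (VNP closed under p-projections), is likewise used nowhere on this
line. No item, not the deciding
theorem `closes`, and not the intended proof of the Assembly item mentions any of them: Assembly
(provable now) goes ¬(VP ℂ ≠ VNP ℂ)
⇒ VP ℂ = VNP ℂ ⇒ per is p-computable (`isPComputable_perPoly_complex_iff`, proved, same file) ⇒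
FermionicNormalForm at χ ≡ 1
(a class function; its family is perPoly after `MvPolynomial.C 1 * _ = _`, Mathlib `Matrix.permanent
M = ∑ σ, ∏ i, M (σ i) i`)
gives c with a representation of length ≤ 2^((log₂ n + c)^c) for every n ≥ 1, and n = 0 is served by
r = 1 (per of the empty
matrix = 1 = det of the empty matrix), contradicting TdrPerNotQP. The constant-level cone of the 12
route decls (`#h21_route_deps`,
native preview 2026-08-15T16:26Z: 37 project constants — perPoly, IsPComputable, IsPBounded,
complexity, ArithCircuit.*, VP, VNP,
boolSum, PolyFamily, Literature.PNP.ValiantHypothesis, ValiantsHypothesis — axioms ⊆ {propext,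
Classical.choice, Quot.sound}, no
sorry) contains no conjecture leaf and no undischarged named fact; this edit re-elaborates the file
so the route's `staffable`
deps are populated from that cone. Thesis `Lean:` line synced with the filed
Target/FermionicNormalForm decls (the `1 ≤ n →`
guard of X2: at n = 0 a sum of r twisted 0×0 determinants is the constant r, so the unguarded X2
fails for χ₀(id) ∉ ℕ).
Serve the route.

Novelty: Searches (2026-08-15): `lit frontier ValiantsHypothesis --since 2020` (30 rows; none on
Hadamard-twisted determinant
sums; doi:10.1090/bull/1880 asymptotic spectra survey noted for DirectSumExp); `lit bridges
ValiantsHypothesis --cross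
any` (30 rows, textbooks/surveys only); `lit search --source crossref "permanent as linear
combination of determinants
of Hadamard products"` (6 rows, Hadamard-product inequalities only); `… "k-Pfaffian graphs Pfaffian
number Norine"`
(Norine 2005/2008/2009, Norine–Thomas 2008 = the ±1/group-labelling r=1 and k-Pfaffian theory); `…
"Tensor rank is not
multiplicative under the tensor product"` (doi:10.1016/j.laa.2017.12.020, doi:10.1137/18m1174829);
`… "X-rank tensor
power asymptotic rank with respect to a variety"` (Ballico X-rank papers, nothing on tensor powers
of a point);
`lit search --source zbmath "permanent sum of determinants complex weights"` (0); `lit galaxy search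
--star all` for
"sum of two determinants" (8 textbook hits), "permanent as a sum of determinants" (0), "rank with
respect to a variety"
(2: matrix completion, Chiantini volume), "Pfaffian number" / "linear combination of determinants"
(galaxyd saturated,
0 returned); local searchd down (connection reset), arXiv/OpenAlex HTTP 429 — recorded in NOTES.
Plus the card's and
two refuter audits' searches (LoeblMasbaum2011, Tesler2000, Norine, Miranda–Lucchesi,
IkenmeyerLandsberg2017 found there).
Nearest prior art found: Tesler2000 (2^h Pfaffians with entries ±1, ±i for graphs of  [refs: 10.1090/bull/1880, 10.1016/j.laa.2017.12.020, 10.1137/18m1174829, 10.1007/s00493-009-2354-0, 0908.2925, doi:10.1090/bull/1880, doi:10.1016/j.laa.2017.12.020, doi:10.1137/18m1174829, doi:10.1007/s00493-009-2354-0, LoeblMasbaum2011, Tesler2000, IkenmeyerLandsberg2017, MarcusMinc1961]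

Barriers (technique_class: restricted-model, toric-secant-rank, normal-form-transfer): - technique_class: restricted-model, toric-secant-rank, normal-form-transfer
- Literature.Barriers.ValiantsHypothesis.PartialDerivativesDetPerm: not evaded but irrelevant by a
stronger statement — every flattening of the Birkhoff cone along a sub-family on which cone elements
factor also factors sgn (the planner's check: a sub-family {σ_{x,y}} with E^σ = F(x)G(y) forces
σ_{x,y} ∈ Bij(R₁,C₁) × Bij(R₂,C₂), where sgn is a product), so X1/DirectSumExp must use
non-flattening structure (nullity equations, substitution with cone geometry, degenerations); the
bet is that the 6-dimensional direct-sum problem is small enough for new invariants.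
- Literature.Barriers.ValiantsHypothesis.RankMethods: same — rank measures μ_L are sub-additive and
bounded by ambient tensor rank, which is 1 for sgn_3^{⊗m}; the line cannot use them and does not
try.
- Literature.Barriers.ValiantsHypothesis.RankLifting: same remark (lifted rank methods see only
ambient rank); not engaged.
- Literature.Barriers.ValiantsHypothesis.AlgebraicNaturalProofs: X1 is a statement about one
explicit point versus σ_r of one explicit toric variety inside ℂ^{n!}; a proof by an equation of
σ_r(X_{B_n}) non-vanishing at sgn is natural only in the n!-dimensional coefficient slice, where the
succinct-hitting-set hypothesis is not known to bite; honest: not evaded in principle, the bet is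
the restricted model.
- Literature.Barriers.ValiantsHypothesis.PermanentCharTwo: respected — in characteristic 2 sgn = 1
and tdr(per) = 1; ev

Novelty grade: new-combination — ROUTE REVIEW (refuter rreview 2026-08-15). STATE: not materialised (rev=0, no Theses file, no items); route workitem held by refuter-refute-pool-g41-10. Target TdrPerNotQP∧FermionicNormalForm from the thesis elaborates rc0 (W2.lean); conventions consistent (Mathlib det = Σ sgn σ Π M(σ i) i; perPoly  (refuter refuter-rreview-route-AtomisticToContinu-35415862-0, 2026-08-15T13:48:54Z; prior: LoeblMasbaum2011 arXiv:0908.2925, Tesler2000 JCTB 78, MarcusMinc1961, doi:10.1016/j.laa.2017.12.020, doi:10.1007/s00493-009-2354-0 (Norine), card audit-12 refuter-novelty-audit-ValiantsHypothesis-12-0)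

History (route lifecycle, newest last):
- 2026-08-23T12:36:40Z · DORMANT — reconciler: no traction for 6.1 d (last activity statement-grounded at 2026-08-17T10:11:23Z); parked, not closed — `ledger route dormant route-ValiantsHypothesi (operator:999:3466159)
- 2026-08-26T06:38:08Z · REACTIVATED — reconciler: reactivated — activity item-proof-filed at 2026-08-26T05:12:39Z after parking at 2026-08-23T12:36:40Z (operator:999:727954)
- 2026-08-27T19:00:57Z · DORMANT — tenure g2 per director-valiant g8 2026-08-27T17:55:59Z (2): both open conjuncts calibrated ≥ VNP⊄VBP (p551099/p552122/p551732); natural target = FRONTIER statem (planner-tenure-valiant-dormant-sweep-g2-0)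

sub-problem: ValiantsHypothesis · status: dormant · opened planner-plancard-ValiantsHypothesis-ValiantsH-49b4610a-0 2026-08-15T11:45:30Z · rev 13 · ledger route-ValiantsHypothesis-TwistedDetRank
GENERATED by the gate from the ledger (D-0016/17). Provers cite these decls: `theorem foo : Summit.ValiantsHypothesis.ValiantsHypothesis.Theses.TwistedDetRank.<Decl> := …` in Summits/ValiantsHypothesis/ValiantsHypothesis/Theorems/<Name>.lean.
-/

namespace Summit.ValiantsHypothesis.ValiantsHypothesis.Theses.TwistedDetRank

open scoped BigOperators Topology Manifold Classical MeasureTheory ProbabilityTheory Matrix InnerProductSpace ComplexConjugate ContinuousMap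
open Filter Set Function TopologicalSpace MeasureTheory

attribute [summit_statement] _root_.ValiantsHypothesis

open Literature.PNP

/-- item stmt-ValiantsHypothesis-6282 · target · rank 0 · open · by planner
why it might fail: X2 has no mechanism of its own on the class-function slice beyond classification of cheap class functions, and X1 needs a lower-bound technique past flattenings, Arf invariants and Hessian rank.
sources: MarcusMinc1961, Tesler2000, LoeblMasbaum2011, Curticapean2021
[target] X = TdrPerNotQP ∧ FermionicNormalForm (X1 ∧ X2 of the Thesis; written out in full so the
decl has no forward references). -/
@[route_item "route-ValiantsHypothesis-TwistedDetRank"]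
def Target : Prop :=
  (¬ ∃ c : ℕ, ∀ n : ℕ, ∃ r ≤ 2 ^ ((Nat.log 2 n + c) ^ c), ∃ E : Fin r → Matrix (Fin n) (Fin n) ℂ, Literature.Computability.AlgebraicComplexity.perPoly (Fin n) ℂ = ∑ t, (Matrix.of fun i j => MvPolynomial.C (E t i j) * MvPolynomial.X (i, j)).det) ∧ (∀ χ : (n : ℕ) → Equiv.Perm (Fin n) → ℂ, (∀ (n : ℕ) (σ τ : Equiv.Perm (Fin n)), χ n (τ * σ * τ⁻¹) = χ n σ) → Literature.Computability.AlgebraicComplexity.IsPComputable (fun n => ∑ σ : Equiv.Perm (Fin n), MvPolynomial.C (χ n σ) * ∏ i : Fin n, (MvPolynomial.X (σ i, i) : MvPolynomial (Fin n × Fin n) ℂ)) → ∃ c : ℕ, ∀ n : ℕ, 1 ≤ n → ∃ r ≤ 2 ^ ((Nat.log 2 n + c) ^ c), ∃ E : Fin r → Matrix (Fin n) (Fin n) ℂ, (∑ σ : Equiv.Perm (Fin n), MvPolynomial.C (χ n σ) * ∏ i : Fin n, (MvPolynomial.X (σ i, i) : MvPolynomial (Fin n × Fin n) ℂ)) = ∑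 t, (Matrix.of fun i j => MvPolynomial.C (E t i j) * MvPolynomial.X (i, j)).det)

/-- item stmt-ValiantsHypothesis-6283 · crux · rank 2 · open · by planner
why it might fail: A p-computable class-function family with cuspidal support and no short expansion: D^even_n = sgn·[all cycles even] or the even half of Ferm_2, if either is in VP; or a family supported on permutations moving ≤ polylog n points whose tdr is not quasi-polynomial.
sources: Curticapean2021, MertensMoore2013, Burgisser2000, Tesler2000, arXiv:quant-ph/0012094
[crux] (card thesis (B), class-function slice) for every family χ_n of class functions on S_n, if
f_n = Σ_σ χ_n(σ) Π_i X_{σ(i),i} is p-computable over ℂ then there is c with tdr(f_n) ≤ 2^((log₂ n +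
c)^c) for all n, i.e. f_n is a sum of quasi-polynomially many twisted determinants ("every
efficiently computable class-function permutation amplitude is a short superposition of free-fermion
amplitudes"). Consistent with all known cheap class functions: sgn·F(c_1)·P(c_2..c_k) (interpolation
in det(X∘(J+(u−1)I)) and cycle twists) and functions supported on permutations moving ≤ k points
(moment/Prony twists I + rank-one) have polynomial tdr; per, HC, fermionants, D^even are believed
hard. [difficulty: open-problem] -/
@[route_item "route-ValiantsHypothesis-TwistedDetRank", crux]
def FermionicNormalForm : Prop :=
  ∀ χ : (n : ℕ) → Equiv.Perm (Fin n) → ℂ, (∀ (n : ℕ) (σ τ : Equiv.Perm (Fin n)), χ n (τ * σ * τ⁻¹) = χ n σ) → Literature.Computability.AlgebraicComplexity.IsPComputable (fun n => ∑ σ : Equiv.Perm (Fin n), MvPolynomial.C (χ n σ) * ∏ i : Fin n, (MvPolynomial.X (σ i, i) : MvPolynomial (Fin n × Fin n) ℂ)) → ∃ c : ℕ, ∀ n : ℕ, 1 ≤ n → ∃ r ≤ 2 ^ ((Nat.log 2 n + c) ^ c), ∃ E : Fin r → Matrix (Fin n) (Fin n) ℂ, (∑ σ : Equiv.Perm (Fin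 n), MvPolynomial.C (χ n σ) * ∏ i : Fin n, (MvPolynomial.X (σ i, i) : MvPolynomial (Fin n × Fin n) ℂ)) = ∑ t, (Matrix.of fun i j => MvPolynomial.C (E t i j) * MvPolynomial.X (i, j)).det

/-- item stmt-ValiantsHypothesis-6284 · crux · rank 3 · closed · proved by Summit.ValiantsHypothesis.ValiantsHypothesis.Theorems.tdrPerNotQP_proof @ cd73b5671846 (prover) · by planner
why it might fail: False only if per_n is a 2^polylog-term sum of twisted determinants (a VQP-type normal form, against DetQP's thesis); the live risk is unprovability: flattenings are blind (cone elements factor exactly where sgn factors), Arf invariants need ±1 twists, Hessian rank gives only ~n/2.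
sources: MignonRessayre2004, MarcusMinc1961, LoeblMasbaum2011, Tesler2000, doi:10.1007/s00493-009-2354-0, IkenmeyerLandsberg2017
[crux] (card thesis (A), in the form the assembly consumes) the twisted-determinantal rank of the
permanent is not quasi-polynomially bounded: there is no c such that for every n, per_n is a sum of
at most 2^((log₂ n + c)^c) polynomials det(X∘E_t), E_t ∈ ℂ^{n×n}. Equivalently sgn ∈ ℂ^{S_n} is not
a sum of quasi-polynomially many points of the Birkhoff cone {π ↦ Π_i E_{π(i),i}}. Implied by
DetQP's thesis (dc of a sum of r twisted n×n determinants is poly(r,n)); known: ⌊n/3⌋+1 ≤ tdr(per_n)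
≤ n!. [difficulty: open-problem] -/
@[route_item "route-ValiantsHypothesis-TwistedDetRank", crux]
def TdrPerNotQP : Prop :=
  ¬ ∃ c : ℕ, ∀ n : ℕ, ∃ r ≤ 2 ^ ((Nat.log 2 n + c) ^ c), ∃ E : Fin r → Matrix (Fin n) (Fin n) ℂ, Literature.Computability.AlgebraicComplexity.perPoly (Fin n) ℂ = ∑ t, (Matrix.of fun i j => MvPolynomial.C (E t i j) * MvPolynomial.X (i, j)).det

-- `TdrPerNotQP` holds: proved by `Summit.ValiantsHypothesis.ValiantsHypothesis.Theorems.tdrPerNotQP_proof` @ cd73b5671846 (its module imports this route file, so no `_holds` link can be stated here).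

/-- item stmt-ValiantsHypothesis-17991 · crux · rank 6 · open · by planner
why it might fail: Polynomial dc but exponential tdr: the 2-cycle twist χ = sgn·μ^{c₂} (μ ≠ ±1) has tdr ≥ 2^{n/4} by the landed block-swap flattening; it refutes X2b iff its GMF Σ_M (1−μ)^{|M|} X^M det(X_{M̄}) has polynomial dc (expected VNP-hard, Burgisser2000 Ch. 7; open).
sources: LandsbergRessayre2017, DawarWilsenach2025, DawarPagoSeppelt2025, Curticapean2021, Burgisser2000, MarcusMinc1961
[crux] (X2b, NORMAL-FORM side of the VBP redirect of FermionicNormalForm) fermionic normal form on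
the VBP slice: a class-function GMF family with affine determinantal representations of p-bounded
size is, for n ≥ 1, a sum of quasi-polynomially many Hadamard-twisted determinants det(X∘E_t).
Carries the route's mechanism; kernel-checked calibration: SliceVBPFermionic → DcPerSuperpolynomial
ℂ (VNP ⊄ VBP, via the proved tdr(per_{3m}) ≥ (3/2)^m), and it is consistent with VP ℂ = VNP ℂ (world
VBP ⊊ VP = VNP), so not the summit. The class-function hypothesis is load-bearing (per_3^{⊕m}: dc =
O(m), tdr ≥ (3/2)^m, landed). Its content is a GRADED transfer dc ≤ n^k ⇒ tdr ≤ 2^{(log n)^{g(k)}}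
(a transfer uniform in dc would, with the proved VP ⊆ VQP-in-dc, give FermionicNormalForm outright);
intended line: symmetrise a polynomial-size determinantal representation over the diagonal S_n
(Landsberg2017 §7.4.1, LandsbergRessayre2017) at quasi-polynomial cost, then read quasi-locality of
χ off the symmetric object (DawarWilsenach2025 supports, DawarPagoSeppelt2025 Thm 3.5) and expand by
the landed LocalGeneratorsSmallTdr. -/
@[route_item "route-ValiantsHypothesis-TwistedDetRank", crux]
def SliceVBPFermionic : Prop :=
  ∀ χ : (n : ℕ) → Equiv.Perm (Fin n) → ℂ, (∀ (n : ℕ) (σ τ : Equiv.Perm (Fin n)), χ n (τ * σ * τ⁻¹) = χ n σ) → (∃ c : ℕ, ∀ n : ℕ, ∃ m ≤ n ^ c + c, Literature.Computability.AlgebraicComplexity.HasDetRepr (∑ σ : Equiv.Perm (Fin n), MvPolynomial.C (χ n σ) * ∏ i : Fin n, (MvPolynomial.X (σ i, i) : MvPolynomial (Fin n × Fin n) ℂ)) m) → ∃ c : ℕ, ∀ n : ℕ, 1 ≤ n → ∃ r ≤ 2 ^ ((Nat.log 2 n + c) ^ c), ∃ E : Fin r → Matrix (Fin n) (Fin n)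 ℂ, (∑ σ : Equiv.Perm (Fin n), MvPolynomial.C (χ n σ) * ∏ i : Fin n, (MvPolynomial.X (σ i, i) : MvPolynomial (Fin n × Fin n) ℂ)) = ∑ t, (Matrix.of fun i j => MvPolynomial.C (E t i j) * MvPolynomial.X (i, j)).det

/-- item stmt-ValiantsHypothesis-17992 · crux · rank 8 · open · by planner
why it might fail: VP ≠ VBP may already show on the slice: a p-computable class-function GMF needing dc n^{ω(1)}, e.g. a symmetric-cheap bounded-treewidth hom combination (DawarPagoSeppelt2025 Thm 1.1, VP-complete flavour) that is not skew-computable; none known, no superpolynomial dc bound exists.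
sources: MalodPortier2008, Burgisser2000, MignonRessayre2004, DawarPagoSeppelt2025, RazYehudayoff2008
[crux] (X2a, COLLAPSE side of the VBP redirect of FermionicNormalForm) the class-function slice of
VP lies in VBP: if χ_n are class functions on S_n and the GMF family f_n = Σ_σ χ_n(σ) Π_i X_{σ(i),i}
is p-computable over ℂ, then f_n has affine determinantal representations of p-bounded size, dc(f_n)
≤ n^c + c (Literature HasDetRepr; VBP = p-bounded dc, MalodPortier2008/Toda). A graded VP→VBP
collapse on the slice, i.e. an UPPER-bound statement; consistent with VP ℂ = VNP ℂ (world VBP = VP =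
VNP), so not the summit: SliceVPInVBP → VH would be a proof of DcPerSuperpolynomial ℂ
(kernel-checked: SliceVPInVBP → DcPerSuperpolynomial ℂ → VH, strategist file
Cruxes/FermionicNormalForm/Split/SliceVBP.lean). Every class-function GMF KNOWN to be in VP is a
short twisted-determinant sum and has POLYNOMIAL dc. -/
@[route_item "route-ValiantsHypothesis-TwistedDetRank", crux]
def SliceVPInVBP : Prop :=
  ∀ χ : (n : ℕ) → Equiv.Perm (Fin n) → ℂ, (∀ (n : ℕ) (σ τ : Equiv.Perm (Fin n)), χ n (τ * σ * τ⁻¹) = χ n σ) → Literature.Computability.AlgebraicComplexity.IsPComputable (fun n => ∑ σ : Equiv.Perm (Fin n), MvPolynomial.C (χ n σ) * ∏ i : Fin n, (MvPolynomial.X (σ i, i) : MvPolynomial (Fin n × Fin n) ℂ)) → ∃ c : ℕ, ∀ n : ℕ, ∃ m ≤ n ^ c + c, Literature.Computability.AlgebraicComplexity.HasDetRepr (∑ σ : Equiv.Perm (Fin n), MvPolynomial.C (χ n σ) * ∏ i : Fin n, (MvPolynomial.X (σ i, i) : MvPolynomial (Fin n × Fin n) ℂ)) m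

/-- item stmt-ValiantsHypothesis-6285 · banked · rank 4 · closed · proved by Summit.ValiantsHypothesis.ValiantsHypothesis.Theorems.TwistedDetRankDirectSumExpProof.directSumExp_proof (prover) · by planner
why it might fail: R(2)=3<4 already (both factor sets = the 3 lines of a plane through sgn); shared-parameter interpolation along rational cubic curves in Y_3, or border-rank degenerations, may give R(m)=poly(m); no lower-bound tool beyond substitution (R(m) ≥ R(m−1)+2) is known.
sources: doi:10.1016/j.laa.2017.12.020, doi:10.1137/18m1174829, doi:10.1090/bull/1880, Landsberg2017, Tesler2000
[crux] (direct-sum dichotomy, exponential side) there is c > 0 such that for all m, every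
representation of per_3 ⊕ … ⊕ per_3 (the product of the permanents of the m diagonal 3×3 blocks of a
(Fin m × Fin 3)-indexed generic matrix) as a sum of r twisted determinants of the full matrix has r
≥ 2^(c·m). Equivalently the Birkhoff-cone(Y_3 ⊂ ℂ^6, the cubic fourfold z_{e1}z_{e2}z_{e3} =
z_{o1}z_{o2}z_{o3}) product rank R(m) of sgn_3^{⊗m} grows exponentially (known m+1 ≤ R(m) ≤ 2^m,
R(1) = 2, R(2) = 3). With TdrBlockMonotone it gives tdr(per_n) ≥ 2^(c⌊n/3⌋), hence TdrPerNotQP; it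
also shows why X2 must live on the class-function slice. Its refutation (R(m) = 2^{o(m)}) would
revive the card's unrestricted (B) and force X1 through global structure. [difficulty: L] -/
@[route_item "route-ValiantsHypothesis-TwistedDetRank", crux]
def DirectSumExp : Prop :=
  ∃ c : ℝ, 0 < c ∧ ∀ (m r : ℕ) (E : Fin r → Matrix (Fin m × Fin 3) (Fin m × Fin 3) ℂ), (∏ b : Fin m, ∑ σ : Equiv.Perm (Fin 3), ∏ i : Fin 3, (MvPolynomial.X ((b, σ i), (b, i)) : MvPolynomial ((Fin m × Fin 3) × (Fin m × Fin 3)) ℂ)) = ∑ t, (Matrix.of fun p q => MvPolynomial.C (E t p q) * MvPolynomial.X (p, q)).det → (2 : ℝ) ^ (c * m) ≤ r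

-- `DirectSumExp` holds: proved by `Summit.ValiantsHypothesis.ValiantsHypothesis.Theorems.TwistedDetRankDirectSumExpProof.directSumExp_proof` (its module imports this route file, so no `_holds` link can be stated here).

/-- item stmt-ValiantsHypothesis-6286 · banked · rank 5 · closed · proved by Summit.ValiantsHypothesis.ValiantsHypothesis.Theorems.TwistedDetRankTdrPerSuperlinearProof.tdrPerSuperlinear_proof (prover) · by planner
why it might fail: Only ⌊n/3⌋+1 ≤ tdr(per_n) is proved; substitution adds O(1) per block and no invariant sees general complex twists; if DirectSumExp fails, linear growth of tdr(per_n) contradicts nothing proved (only the belief VBP ≠ VNP).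
sources: MignonRessayre2004, LoeblMasbaum2011, AlperBogartVelasco2017, doi:10.1016/j.disc.2010.10.014, MarcusMinc1961
[crux] (first honest rung of X1) tdr(per_n)/n → ∞: for every C there is n₀ such that for n ≥ n₀
every representation of per_n as a sum of r twisted determinants has r > C·n. Known: r ≥ ⌊n/3⌋+1
(superadditivity, TdrSuperadditive) and numerically tdr(per_4) = 3, tdr(per_5) ∈ {7, 8} = the
generic rank ⌈n!/((n−1)²+1)⌉ so far. [difficulty: L] -/
@[route_item "route-ValiantsHypothesis-TwistedDetRank"]
def TdrPerSuperlinear : Prop :=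
  ∀ C : ℕ, ∃ n₀ : ℕ, ∀ n ≥ n₀, ∀ (r : ℕ) (E : Fin r → Matrix (Fin n) (Fin n) ℂ), Literature.Computability.AlgebraicComplexity.perPoly (Fin n) ℂ = ∑ t, (Matrix.of fun i j => MvPolynomial.C (E t i j) * MvPolynomial.X (i, j)).det → C * n < r

-- `TdrPerSuperlinear` holds: proved by `Summit.ValiantsHypothesis.ValiantsHypothesis.Theorems.TwistedDetRankTdrPerSuperlinearProof.tdrPerSuperlinear_proof` (its module imports this route file, so no `_holds` link can be stated here).

/-- item stmt-ValiantsHypothesis-6287 · support · rank 6 · closed · proved by Summit.ValiantsHypothesis.ValiantsHypothesis.Theorems.tdrBlockMonotone_proof @ 94cfaf8d29bc (prover) · by planner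
sources: Valiant1979, MarcusMinc1961
[support] block restriction keeps the number of twisted determinants: if 3m ≤ n and per_n is a sum
of r twisted determinants then per_3 ⊕ … ⊕ per_3 (m blocks, (Fin m × Fin 3)-indexed) is a sum of r
twisted determinants (evaluate off-block variables to 0 and leftover diagonal variables to 1; a
twisted determinant maps to a scalar multiple of a block-diagonally twisted determinant).
[difficulty: provable-now] -/
@[route_item "route-ValiantsHypothesis-TwistedDetRank"]
def TdrBlockMonotone : Prop :=
  ∀ (n m r : ℕ), 1 ≤ m → 3 * m ≤ n → ∀ E : Fin r → Matrix (Fin n) (Fin n) ℂ, Literature.Computability.AlgebraicComplexity.perPoly (Fin n) ℂ = ∑ t, (Matrix.of fun i j => MvPolynomial.C (E t i j) * MvPolynomial.X (i, j)).det → ∃ E' : Fin r → Matrix (Fin m × Fin 3) (Fin m × Fin 3) ℂ, (∏ b : Fin m, ∑ σ : Equiv.Perm (Fin 3), ∏ i : Fin 3, (MvPolynomial.X ((b, σ i), (b, i)) : MvPolynomial ((Fin m × Fin 3) × (Fin m × Fin 3)) ℂ)) = ∑ t, (Matrix.of fun p q => MvPolynomial.C (E' t p q) * MvPolynomial.X (p,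 q)).det

-- `TdrBlockMonotone` holds: proved by `Summit.ValiantsHypothesis.ValiantsHypothesis.Theorems.tdrBlockMonotone_proof` @ 94cfaf8d29bc (its module imports this route file, so no `_holds` link can be stated here).

/-- item stmt-ValiantsHypothesis-6288 · support · rank 7 · closed · proved by Summit.ValiantsHypothesis.ValiantsHypothesis.Theorems.directSumToTdr_proof @ baea83817c0d (prover) · by planner
sources: Burgisser2000
[support] glue: DirectSumExp and TdrBlockMonotone imply TdrPerNotQP (2^(c⌊n/3⌋) eventually exceeds
2^((log₂ n + c')^c'); elementary real analysis plus the two items). [difficulty: provable-now] -/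
@[route_item "route-ValiantsHypothesis-TwistedDetRank"]
def DirectSumToTdr : Prop :=
  DirectSumExp → TdrBlockMonotone → TdrPerNotQP

-- `DirectSumToTdr` holds: proved by `Summit.ValiantsHypothesis.ValiantsHypothesis.Theorems.directSumToTdr_proof` @ baea83817c0d (its module imports this route file, so no `_holds` link can be stated here).

/-- item stmt-ValiantsHypothesis-17993 · support · rank 9 · closed · proved by Summit.ValiantsHypothesis.ValiantsHypothesis.Theorems.TwistedDetRank.fermionicNormalFormOfSlices_proof (prover) · by planner
sources: Burgisser2000, MalodPortier2008
[support] glue of the BC2 redirect of the deciding crux: SliceVPInVBP and SliceVBPFermionic imply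
FermionicNormalForm (composition; proof term `fun h1 h2 χ hχ hc => h2 χ hχ (h1 χ hχ hc)`,
kernel-checked as fermionicNormalForm_of_subs in Cruxes/FermionicNormalForm/SplitVBP.lean, commit
2aa417da056b). Once landed under Theorems, `ledger route edit
route-ValiantsHypothesis-TwistedDetRank --split FermionicNormalForm --into <children> --glue-by
<it>` makes FermionicNormalForm DERIVED (split verb is final-cycle-only for seats; children = these
two items). [difficulty: provable-now] [deps: SliceVPInVBP, SliceVBPFermionic] -/
@[route_item "route-ValiantsHypothesis-TwistedDetRank", crux]
def FermionicNormalFormOfSlices : Prop :=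
  SliceVPInVBP → SliceVBPFermionic → FermionicNormalForm

-- `FermionicNormalFormOfSlices` holds: proved by `Summit.ValiantsHypothesis.ValiantsHypothesis.Theorems.TwistedDetRank.fermionicNormalFormOfSlices_proof` (its module imports this route file, so no `_holds` link can be stated here).

/-- item stmt-ValiantsHypothesis-21368 · aside · rank 9 · open · by planner
[support] SymA — SYMMETRIC CIRCUITS SEE ONLY QUASI-LOCAL CLASS FUNCTIONS (banked context, ASIDE: no
crux, no seat; director-valiant g8 2026-08-27T17:55:59Z (2)): if the generalised matrix function
family f_n = Σ_σ χ_n(σ) Π_i X_{σ(i),i} of χ is computed by S_n-symmetric labelled arithmetic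
circuits (Dawar–Wilsenach model, Literature.Computability.AlgebraicComplexity.LabelledArithCircuit,
IsSymmetric for the diagonal S_n action) of size ≤ 2^((log₂ n + c)^c), then χ is QUASI-LOCAL: for n
≥ 1 a linear combination of ≤ 2^((log₂ n + c')^c') local generators of weight ≤ (log₂ n + c')^c'
(fermionic ends sgn·F(#fixed points)·Π c_j(σ), or cycle-type functions supported on permutations
moving ≤ w points) — IsQuasiLocal / IsLocalGenerator of
Theorems/TwistedDetRankFermionicNormalFormDefs.lean unfolded verbatim (that module imports this
route file, so the notion is inlined; `Iff.rfl` with 17991-p1's hypothesis hS checked in the tenure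
folder scratch/SymA_defeq.lean, rc 0). This is the VH-FREE RESIDUE of the calibrated crux
SliceVBPFermionic (X2b): landed
`Theorems.TwistedDetRankSliceVBPFermionic.sliceVBPFermionic_of_symA_of_restorationVBP : SymA →
restorationVBP → SliceVBPFermionic` (p551732) w -/
@[route_item "route-ValiantsHypothesis-TwistedDetRank"]
def SymA : Prop :=
  ∀ χ : (n : ℕ) → Equiv.Perm (Fin n) → ℂ, (∃ c : ℕ, ∀ n : ℕ, ∃ (G : Type) (_ : Fintype G) (C : Literature.Computability.AlgebraicComplexity.LabelledArithCircuit ℂ (Fin n × Fin n) Unit G), C.IsSymmetric (Equiv.Perm (Fin n)) ∧ C.eval (C.output ()) = (∑ σ : Equiv.Perm (Fin n), MvPolynomial.C (χ n σ) * ∏ i : Fin n, (MvPolynomial.X (σ i, i) : MvPolynomial (Fin n × Fin n) ℂ)) ∧ Fintype.card G ≤ 2 ^ ((Nat.log 2 n + c) ^ c)) → ∃ c : ℕ, ∀ n : ℕ, 1 ≤ n → ∃ r ≤ 2 ^ ((Nat.log 2 n + c) ^ c), ∃ (a : Fin r → ℂ) (g : Fin r → Equiv.Perm (Fin n) → ℂ),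 (∀ t, (∃ (F : ℕ → ℂ) (m : Multiset ℕ), (∀ j ∈ m, 2 ≤ j) ∧ m.sum ≤ (Nat.log 2 n + c) ^ c ∧ g t = fun σ => ((Equiv.Perm.sign σ : ℤ) : ℂ) * F (Finset.univ.filter fun i => σ i = i).card * (m.map fun j => ((σ.cycleType.count j : ℕ) : ℂ)).prod) ∨ (∃ G : Multiset ℕ → ℂ, g t = fun σ => if σ.support.card ≤ (Nat.log 2 n + c) ^ c then G σ.cycleType else 0)) ∧ χ n = ∑ t, a t • g t

/-- item stmt-ValiantsHypothesis-6289 · support · rank 9 · closed · proved by Summit.ValiantsHypothesis.ValiantsHypothesis.Theorems.tdrSuperadditive_proof @ bdc4fd8095c7 (prover) · by planner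
sources: MarcusMinc1961, doi:10.1016/j.laa.2017.12.020
[support] superadditivity tdr(per_{a+b}) ≥ tdr(per_a) + tdr(per_b) − 1, in representation form: from
a length-r representation of per_{a+b} one gets representations of per_a and per_b of lengths r₁, r₂
with r₁ + r₂ ≤ r + 1 (restrict to S_a × S_b: sgn_a ⊗ sgn_b = Σ_t u_t ⊗ v_t with u_t, v_t in the
cones; a functional e with e(sgn_a) = 1 killing tdr(per_a) − 1 of the u_t leaves sgn_b as a
combination of the remaining v_t). Gives tdr(per_n) ≥ ⌊n/3⌋ + 1 with TdrPerThree's converse bound r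
= 1 impossible. [difficulty: provable-now] -/
@[route_item "route-ValiantsHypothesis-TwistedDetRank"]
def TdrSuperadditive : Prop :=
  ∀ (a b r : ℕ) (E : Fin r → Matrix (Fin (a + b)) (Fin (a + b)) ℂ), Literature.Computability.AlgebraicComplexity.perPoly (Fin (a + b)) ℂ = ∑ t, (Matrix.of fun i j => MvPolynomial.C (E t i j) * MvPolynomial.X (i, j)).det → ∃ (r₁ r₂ : ℕ) (E₁ : Fin r₁ → Matrix (Fin a) (Fin a) ℂ) (E₂ : Fin r₂ → Matrix (Fin b) (Fin b) ℂ), r₁ + r₂ ≤ r + 1 ∧ Literature.Computability.AlgebraicComplexity.perPoly (Fin a) ℂ = ∑ t, (Matrix.of fun i j => MvPolynomial.C (E₁ t i j) * MvPolynomial.X (i, j)).det ∧ Literature.Computability.AlgebraicComplexity.perPoly (Fin b) ℂ = ∑ t, (Matrix.of fun i j => MvPolynomial.C (E₂ t i j) * MvPolynomial.X (i, j)).det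

-- `TdrSuperadditive` holds: proved by `Summit.ValiantsHypothesis.ValiantsHypothesis.Theorems.tdrSuperadditive_proof` @ bdc4fd8095c7 (its module imports this route file, so no `_holds` link can be stated here).

/-- item stmt-ValiantsHypothesis-6290 · support · rank 9 · closed · proved by Summit.ValiantsHypothesis.ValiantsHypothesis.Theorems.tdrPerThree_proof @ 1e9f87128560 (prover) · by planner
sources: Tesler2000, MarcusMinc1961, AlperBogartVelasco2017
[support] calibration tdr(per_3) ≤ 2: per_3 = a·det(X) + (1−a)·det(X∘F) with F =
[[1,z²,1],[1,1,z²],[z²,1,1]], z = e^{2πi/3}, a = (1+z)/(1−z) (F^ = 1 on A_3, z² on odd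
permutations); absorb a and 1−a into the first rows. Complex twists beat Tesler's two Gaussian-unit
Pfaffians for K_{3,3} ⊂ RP² only in field of definition (ℚ(ζ_3)); r = 1 is impossible (Marcus–Minc).
[difficulty: provable-now] -/
@[route_item "route-ValiantsHypothesis-TwistedDetRank"]
def TdrPerThree : Prop :=
  ∃ E : Fin 2 → Matrix (Fin 3) (Fin 3) ℂ, Literature.Computability.AlgebraicComplexity.perPoly (Fin 3) ℂ = ∑ t, (Matrix.of fun i j => MvPolynomial.C (E t i j) * MvPolynomial.X (i, j)).det

-- `TdrPerThree` holds: proved by `Summit.ValiantsHypothesis.ValiantsHypothesis.Theorems.tdrPerThree_proof` @ 1e9f87128560 (its module imports this route file, so no `_holds` link can be stated here).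

/-- item stmt-ValiantsHypothesis-6291 · support · rank 9 · closed · proved by Summit.ValiantsHypothesis.ValiantsHypothesis.Theorems.TwistedDetRank.tdrPerFactorial_proof @ a8e645894e34 (prover) · by planner
sources: Valiant1979, MarcusMinc1961
[support] trivial upper bound tdr(per_n) ≤ n!: per_n = Σ_τ sgn(τ)·det(X∘P_τ) over the n! permutation
matrices (first exercise for the twisted-determinant API; the true order is open between linear and
n!, numerics suggest the generic rank ⌈n!/((n−1)²+1)⌉). [difficulty: provable-now] -/
@[route_item "route-ValiantsHypothesis-TwistedDetRank"]
def TdrPerFactorial : Prop :=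
  ∀ n : ℕ, ∃ E : Fin (Nat.factorial n) → Matrix (Fin n) (Fin n) ℂ, Literature.Computability.AlgebraicComplexity.perPoly (Fin n) ℂ = ∑ t, (Matrix.of fun i j => MvPolynomial.C (E t i j) * MvPolynomial.X (i, j)).det

-- `TdrPerFactorial` holds: proved by `Summit.ValiantsHypothesis.ValiantsHypothesis.Theorems.TwistedDetRank.tdrPerFactorial_proof` @ a8e645894e34 (its module imports this route file, so no `_holds` link can be stated here).

/-- item stmt-ValiantsHypothesis-6292 · assembly · rank 1 · closed · proved by Summit.ValiantsHypothesis.ValiantsHypothesis.Theorems.TwistedDetRank.assembly_proof @ bc2ea7a8e3ae (prover) · by planner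
sources: Burgisser2000, Valiant1979
[assembly] TdrPerNotQP → FermionicNormalForm → ValiantsHypothesis. -/
@[route_item "route-ValiantsHypothesis-TwistedDetRank"]
def Assembly : Prop :=
  TdrPerNotQP → FermionicNormalForm → ValiantsHypothesis

-- `Assembly` holds: proved by `Summit.ValiantsHypothesis.ValiantsHypothesis.Theorems.TwistedDetRank.assembly_proof` @ bc2ea7a8e3ae (its module imports this route file, so no `_holds` link can be stated here).

/-! D-0027 §2.1 — DECIDING THEOREM (planner-authored via `route open/edit --closes-file`; by planner-tenure-valiant-dormant-sweep-g1-0 2026-08-27T17:02:15Z):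
its hypotheses are this route's items and its conclusion the sub-problem Statement (glue_lint), and it elaborates with this file. -/

@[closes "route-ValiantsHypothesis-TwistedDetRank"] theorem closes (hX1 : TdrPerNotQP) (hX2a : SliceVPInVBP) (hX2b : SliceVBPFermionic)
    (hGlue : FermionicNormalFormOfSlices) : _root_.ValiantsHypothesis := by
  -- D-0027 §2.1 deciding theorem, rev 7 (tenure g1, A1): the deciding crux X2 = `FermionicNormalForm`
  -- (stmt-6283) is now DERIVED from its two VBP-redirect pieces X2a `SliceVPInVBP` (stmt-17992,
  -- collapse side) and X2b `SliceVBPFermionic` (stmt-17991, normal-form side) through the PROVED glue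
  -- item `FermionicNormalFormOfSlices` (stmt-17993, Theorems/TwistedDetRankFermionicNormalFormOfSlices.lean);
  -- X1 `TdrPerNotQP` is PROVED (stmt-6284). Open load-bearing binders: X2a, X2b (neither alone gives S:
  -- Cruxes/FermionicNormalForm/SplitVBP.md (c)). Rest of the proof unchanged from rev 6:
  -- ¬(VP ℂ ≠ VNP ℂ) ⇒ VP ℂ = VNP ℂ ⇒ PER p-computable over ℂ (`isPComputable_perPoly_complex_iff`)
  -- ⇒ per_n is the class-function GMF with χ ≡ 1, so X2 gives a quasi-polynomial twisted-determinant
  -- representation for every n ≥ 1 (n = 0: r = 1), contradicting X1.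
  have hX2 : FermionicNormalForm := hGlue hX2a hX2b
  show Literature.Computability.AlgebraicComplexity.VP ℂ ≠ Literature.Computability.AlgebraicComplexity.VNP ℂ
  intro hEq
  have hper : Literature.Computability.AlgebraicComplexity.IsPComputable
      (fun n => Literature.Computability.AlgebraicComplexity.perPoly (Fin n) ℂ) :=
    Literature.Computability.AlgebraicComplexity.isPComputable_perPoly_complex_iff.2 hEq
  have hrepr : ∀ n : ℕ, (∑ σ : Equiv.Perm (Fin n), MvPolynomial.C (1 : ℂ) *
        ∏ i : Fin n, (MvPolynomial.X (σ i, i) : MvPolynomial (Fin n × Fin n) ℂ)) =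
      Literature.Computability.AlgebraicComplexity.perPoly (Fin n) ℂ := by
    intro n
    simp [Literature.Computability.AlgebraicComplexity.perPoly, Matrix.permanent]
  have hfun : (fun n => ∑ σ : Equiv.Perm (Fin n), MvPolynomial.C (1 : ℂ) *
        ∏ i : Fin n, (MvPolynomial.X (σ i, i) : MvPolynomial (Fin n × Fin n) ℂ)) =
      (fun n => Literature.Computability.AlgebraicComplexity.perPoly (Fin n) ℂ) := funext hrepr
  have hcomp : Literature.Computability.AlgebraicComplexity.IsPComputable
      (fun n => ∑ σ : Equiv.Perm (Fin n), MvPolynomial.C (1 : ℂ) *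
        ∏ i : Fin n, (MvPolynomial.X (σ i, i) : MvPolynomial (Fin n × Fin n) ℂ)) := by
    rw [hfun]; exact hper
  obtain ⟨c, hc⟩ := hX2 (fun _ _ => (1 : ℂ)) (fun _ _ _ => rfl) hcomp
  apply hX1
  refine ⟨c, fun n => ?_⟩
  rcases Nat.eq_zero_or_pos n with rfl | hn
  · refine ⟨1, Nat.one_le_two_pow, fun _ => 0, ?_⟩
    simp [Literature.Computability.AlgebraicComplexity.perPoly, Matrix.permanent_isEmpty, Matrix.det_isEmpty]
  · obtain ⟨r, hr, E, hE⟩ := hc n hn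
    exact ⟨r, hr, E, (hrepr n).symm.trans hE⟩

end Summit.ValiantsHypothesis.ValiantsHypothesis.Theses.TwistedDetRank
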